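import Summits.BirchSwinnertonDyer.BirchSwinnertonDyer.Theorems.ResidualThetaTransportAtTwoRelativeLubinTateBase
import Literature.NumberTheory.GaloisRepresentations.LubinTateDivisionPointsOfSeries
import Literature.NumberTheory.EllipticCurves.SupersingularFormalGroupLubinTateLocalField
import Literature.NumberTheory.EllipticCurves.FormalGroupNilIdealPointsGroupIso
import Literature.NumberTheory.EllipticCurves.FormalGroupNilIdealPointsGalois
import HarnessLib

/-!
# Route `SignedLowerHalves`, crux L `SmallImageLowerHalfBothSigns` (stmt-BirchSwinnertonDyer-23599), line `rtt_w3` v8 — row J, CURVE SIDE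
# (`hJcurve` of `Lines/rtt_w3_JGLUE_spec.lean`), α-half, Stage B: the Lubin–Tate division points `[b]_{g,f} λ_{m+1}` of
# `Ŵ ⊗ 𝒪_F = F_g` (`g = [−p]`) ARE `p^{m+1}`-torsion points of the curve over the Lubin–Tate field `K_{−p}^{m+1}`, additively,
# injectively modulo `π^{m+1}`, and Galois-equivariantly through the Lubin–Tate character

Hand `bsd-inputs-honda-p1` g18 (α-lane of row J; LEAD `cruxlead-stmt-BirchSwinnertonDyer-23599` g5, character half `bsd-line-slh-p3-w3` g16);
helper `--supports stmt-BirchSwinnertonDyer-23599`; THEOREMS ONLY, no `sorry`; closes nothing; BSD / crux L / JD are NOT proved by this.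

SETTING. `F` a non-archimedean local field with a `ℚ_p`-algebra structure, `q_F = p²`, `π := −p` a uniformiser (`F ≅ ℚ_{p²}`);
`V/ℤ_p` a Weierstrass model with elliptic fibres and `a = 0` (`HasseManin.tr = 0`), `P = [−p]` its integral endomorphism;
`U := V ⊗ 𝒪_F` (along `φ = LTCoeff.of ∘ padicIntToInteger`), `g := P ⊗ 𝒪_F ∈ 𝔉_π` and `U.formalGroupLaw = F_g`
(`SupersingularFormalGroupLubinTateLocalField`); `f = πX + X^{q}` the standard series, `λ_{m+1} = genPt` in `𝔪_E`, `E = K_π^{m+1} = ltField π m`;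
`E₁(E) ≃ Ŵ(𝔪_E) = U.Pt (maxNilIdeal F E)` (`kernelEquivPt`, `ptHom`; `ballNilIdeal E = maxNilIdeal F E` definitionally).

* §1 `isElliptic_curveOver` — `U ⊗ E` is an elliptic curve; `formalMul_map_eq_hom` — `[n]_U = [n]_g` (Lubin–Tate's `hom`, uniqueness:
  `[n]` commutes with `g = i∘[p]`, `RelativeLubinTate.formalMul_subst_formalNeg_subst_formalMul'`); `val_nsmul_eq_ltSMul` — on `Ŵ(𝔪_E)`,
  `n • z = [n]_g z`; `natCast_eq_neg_ltCoeff` — `(p : 𝒪_F) = −π`.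
* §2 ★ `pow_smul_ptHom_eq_zero_of_ltSMul_pow_eq_zero` — a `π^{m+1}`-division point `t` of `F_g` in `𝔪_E` gives a `p^{m+1}`-TORSION point
  `P(t) = ptHom ⟨t⟩ ∈ E₁(E)`; ★ `pow_smul_ptHom_divisionPt_eq_zero` — in particular `P([b]_{g,f} λ_{m+1})` is `p^{m+1}`-torsion;
  `ptHom_divisionPt_add` — `P([a]λ) + P([b]λ) = P([a+b]λ)`; ★ `ptHom_divisionPt_eq_iff` — `P([a]λ) = P([b]λ) ↔ π^{m+1} ∣ a − b`.
* §3 ★ `galPointHom_ptHom_divisionPt` — for `σ ∈ Γ_F` with restriction `σ'` to the Galois extension `E`: `σ'(P([b]λ)) = P([χ_π(σ) b]λ)`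
  (`kernelEquivPt_galPointHom` + `absGal_smul_evalPt₁_hom_genPt` of `LubinTateDivisionPointsOfSeries`).

Stage C (next file) maps these points to `W(F̄)[p^{m+1}]`, counts `q^{m+1} = p^{2(m+1)} = #W(F̄)[p^{m+1}]` to get ALL torsion points, and
packages `α : W[p^∞] ≃ F/𝒪_F`, `α(σ t) = χ_π(σ) α(t)`.

References: [SilvermanAEC2009] IV.2.3, VII.2.2; [CasselsFrohlichANT1967] Ch. VI §3.4 Thm. 3, §3.6 Prop. 6; [LubinTate1965] §1 Thm. 1, §2 Thm. 2;
[Kobayashi2003] §8.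
-/

set_option autoImplicit false
-- D-0017: single-problem summit, the namespace repeats the problem name by design.
set_option linter.dupNamespace false
noncomputable section

open scoped Classical
open PowerSeries ValuativeRel WeierstrassCurve Literature.NumberTheory.EllipticCurves
  Literature.NumberTheory.EllipticCurves.FormalGroupChart
  Literature.NumberTheory.GaloisRepresentations Literature.NumberTheory.GaloisRepresentations.IsNonarchimedeanLocalField
  Literature.NumberTheory.GaloisRepresentations.LubinTate

namespace Summit.BirchSwinnertonDyer.BirchSwinnertonDyer.Theorems.SmallImageRttCharRoad

section Local

variable {p : ℕ} [hp : Fact p.Prime] {F : Type} [Field F] [ValuativeRel F] [TopologicalSpace F] [IsNonarchimedeanLocalField F]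
  [Algebra ℚ_[p] F]

-- the normed-field instances on `F` and on the finite subextensions of `F̄` of `LubinTateTorsion.lean` (local instances there)
attribute [local instance] instUniformSpace_literature rk1 nF nE ltCharIsUniformAddGroup

variable (V : WeierstrassCurve ℤ_[p]) [hE : (V.map PadicInt.Coe.ringHom).IsElliptic] [hEt : (V.map PadicInt.toZMod).IsElliptic]
  (ha : Literature.NumberTheory.EllipticCurves.HasseManin.tr (V.map PadicInt.toZMod) = 0)
  {P : ℤ_[p]⟦X⟧} (hP : P.map PadicInt.Coe.ringHom = (V.map PadicInt.Coe.ringHom).formalExp.subst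
    (C ((-(p : ℤ_[p]) : ℤ_[p]) : ℚ_[p]) * (V.map PadicInt.Coe.ringHom).formalLog))
  (hq : residueFieldCard F = p ^ 2)
  (hπ : (valuation F).IsUniformizer ((padicIntToInteger F p (-(p : ℤ_[p])) : 𝒪[F]) : F))

/-! ### §1 The curve and its formal group over a finite extension `E ⊆ F̄` -/

omit hEt in
/-- `U ⊗ E` is an elliptic curve for every finite `E ⊆ F̄` (its discriminant is the image of `Δ(V ⊗ ℚ_p) ≠ 0` under the injective
`ℚ_p → F → E`). [cite: SilvermanAEC2009, III.§1] -/
theorem isElliptic_curveOver (E : IntermediateField F (AlgebraicClosure F)) [FiniteDimensional F E] :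
    (curveOver E (V.map ((LTCoeff.of F : 𝒪[F] →+* LTCoeff F).comp (padicIntToInteger F p)))).IsElliptic := by
  refine ⟨?_⟩
  have hmap : curveOver E (V.map ((LTCoeff.of F : 𝒪[F] →+* LTCoeff F).comp (padicIntToInteger F p))) =
      (V.map PadicInt.Coe.ringHom).map ((algebraMap F E).comp (algebraMap ℚ_[p] F)) := by
    rw [curveOver, ballIntModel, WeierstrassCurve.baseChange, WeierstrassCurve.map_map, WeierstrassCurve.map_map,
      WeierstrassCurve.map_map]
    congr 1
  rw [hmap, WeierstrassCurve.map_Δ, isUnit_iff_ne_zero, map_ne_zero_iff _ (RingHom.injective _)]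
  exact (V.map PadicInt.Coe.ringHom).isUnit_Δ.ne_zero

omit hE hEt in
/-- `coeff 1 ([n]_V) = n` over `ℤ_p` (from the `ℚ_p`-statement `coeff_one_formalMul` on `V ⊗ ℚ_p`). [cite: SilvermanAEC2009, IV.2.3] -/
theorem coeff_one_formalMul_int (n : ℕ) : coeff 1 (V.formalMul n) = n := by
  haveI := V.isIntegral_map_coe
  apply PadicInt.ext
  have h := (V.map PadicInt.Coe.ringHom).coeff_one_formalMul n
  rw [← map_formalMul, coeff_map] at h
  rw [PadicInt.coe_natCast]
  exact h

/-- **`[n]_U = [n]_g`**: the formal multiplication-by-`n` of `U = V ⊗ 𝒪_F` IS Lubin–Tate's endomorphism `hom _ g g n` of `F_g`,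
`g = [−p] ⊗ 𝒪_F` — both are `≡ nX` and commute with `g = i ∘ [p]` (`RelativeLubinTate.formalMul_subst_formalNeg_subst_formalMul'`), so Lubin–Tate
uniqueness applies. [cite: LubinTate1965, §1 Thm. 1] [cite: SilvermanAEC2009, IV.2.3] -/
theorem formalMul_map_eq_hom (n : ℕ) :
    (V.map ((LTCoeff.of F : 𝒪[F] →+* LTCoeff F).comp (padicIntToInteger F p))).formalMul n =
      hom (isLTRing_LTCoeff (F := F) hπ) (V.isLTSeries_map_padicIntToInteger_of_tr_eq_zero F ha hP hq)
        (V.isLTSeries_map_padicIntToInteger_of_tr_eq_zero F ha hP hq) (n : LTCoeff F) := by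
  set φ : ℤ_[p] →+* LTCoeff F := (LTCoeff.of F : 𝒪[F] →+* LTCoeff F).comp (padicIntToInteger F p) with hφ
  have hPeq : P = V.formalNeg.subst (V.formalMul p) := eq_formalNeg_subst_formalMul_of_map_eq hP
  have hg : P.map φ = (V.map φ).formalNeg.subst ((V.map φ).formalMul p) := by
    rw [hPeq]; exact RelativeLubinTate.map_formalNeg_subst_formalMul' V φ p
  refine eq_hom _ _ _ ((V.map φ).constantCoeff_formalMul n) ?_ ?_
  · rw [← map_formalMul, coeff_map, coeff_one_formalMul_int, map_natCast]
  · rw [hg]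
    exact (RelativeLubinTate.formalMul_subst_formalNeg_subst_formalMul' (V.map φ) n p).symm

/-- `(p : 𝒪_F) = −π` in the coefficient ring `LTCoeff F` (`π = −p`). [folklore] -/
theorem natCast_eq_neg_ltCoeff : ((p : ℕ) : LTCoeff F) = -(LTCoeff.of F (padicIntToInteger F p (-(p : ℤ_[p])))) := by
  rw [map_neg, map_natCast, map_neg, map_natCast, neg_neg]

/-- **On `Ŵ(M) = U.Pt M`: `n • z = [n]_g z`** for every closed nil ideal `M` of a complete linearly topologised `𝒪_F`-algebra (the group law of
`Pt` is `F_U = F_g`, `Pt.val_nsmul`, `formalMul_map_eq_hom`). [cite: CasselsFrohlichANT1967, Ch. VI §3.4] [cite: SilvermanAEC2009, IV.2.3] -/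
theorem val_nsmul_eq_ltSMul {S : Type} [CommRing S] [UniformSpace S] [IsUniformAddGroup S] [IsTopologicalRing S]
    [IsLinearTopology S S] [T2Space S] [CompleteSpace S] [Algebra (LTCoeff F) S] [ContinuousSMul (LTCoeff F) S] (M : NilIdeal S) (n : ℕ)
    (z : (V.map ((LTCoeff.of F : 𝒪[F] →+* LTCoeff F).comp (padicIntToInteger F p))).Pt M) :
    (n • z).val = ltSMul M (isLTRing_LTCoeff (F := F) hπ) (V.isLTSeries_map_padicIntToInteger_of_tr_eq_zero F ha hP hq)
      (n : LTCoeff F) z.val := by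
  rw [WeierstrassCurve.Pt.val_nsmul]
  unfold ltSMul evalPt₁
  exact evalPt_congr _ (formalMul_map_eq_hom V ha hP hq hπ n) _ _ _

/-! ### §2 Division points of `F_g` give `p`-power torsion points of the curve (any complete ultrametric `K ⊇ 𝒪_F`) -/

/-- ★ **A `π^{m+1}`-division point of `F_g` in `𝔪_K` is a `p^{m+1}`-torsion point of the curve**, for EVERY complete ultrametric field `K`
carrying a continuous `𝒪_F`-algebra structure on its unit ball (e.g. a finite extension of `F`, or `ℂ_F`): for `t ∈ 𝔪_K` with
`[π^{m+1}]_g t = 0`, the point `P(t) = ptHom ⟨t⟩ ∈ E₁(K)` satisfies `p^{m+1} • P(t) = O` (`p^{m+1} = (−1)^{m+1} π^{m+1}` in `𝒪_F` and `ptHom`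
is additive; `Ŵ(𝔪_K)`'s multiplication by `n` is `[n]_g`, `val_nsmul_eq_ltSMul`).  NOTE for the assembly (Stage C): state point arithmetic
over a GENERIC such `K` — over an `IntermediateField E ⊆ F̄` with the tree's local spectral-norm instance `nE` the group-law instance of
`(curveOver E U).toAffine.Point` is reached along two non-reducibly-equal paths (`E.toField`/`instDecidableEq` vs `nE.toField`/`Classical`),
and `map_add`/`map_nsmul` do not synthesise. [cite: SilvermanAEC2009, Prop. VII.2.2] [cite: CasselsFrohlichANT1967, Ch. VI §3.6 Prop. 6 (a)] -/
theorem pow_smul_ptHom_eq_zero_of_ltSMul_pow_eq_zero {K : Type} [NontriviallyNormedField K] [IsUltrametricDist K] [CompleteSpace K]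
    [Algebra (LTCoeff F) (unitBall K)] [ContinuousSMul (LTCoeff F) (unitBall K)]
    [hEK : (curveOver K (V.map ((LTCoeff.of F : 𝒪[F] →+* LTCoeff F).comp (padicIntToInteger F p)))).IsElliptic] (m : ℕ)
    (t : (ballNilIdeal K).toIdeal)
    (ht : ltSMul (ballNilIdeal K) (isLTRing_LTCoeff (F := F) hπ) (V.isLTSeries_map_padicIntToInteger_of_tr_eq_zero F ha hP hq)
      ((LTCoeff.of F (padicIntToInteger F p (-(p : ℤ_[p])))) ^ (m + 1)) t = 0) :
    p ^ (m + 1) • ptHom K (V.map ((LTCoeff.of F : 𝒪[F] →+* LTCoeff F).comp (padicIntToInteger F p))) ⟨t⟩ = 0 := by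
  set hA := isLTRing_LTCoeff (F := F) hπ
  set hg := V.isLTSeries_map_padicIntToInteger_of_tr_eq_zero F ha hP hq
  have key : p ^ (m + 1) • (⟨t⟩ : (V.map ((LTCoeff.of F : 𝒪[F] →+* LTCoeff F).comp (padicIntToInteger F p))).Pt (ballNilIdeal K)) = 0 := by
    apply WeierstrassCurve.Pt.ext
    rw [WeierstrassCurve.Pt.val_nsmul, WeierstrassCurve.Pt.val_zero]
    change evalPt₁ (ballNilIdeal K) _ _ t = 0
    unfold evalPt₁
    rw [evalPt_congr _ (formalMul_map_eq_hom V ha hP hq hπ (p ^ (m + 1))) _ (constantCoeff_hom hA hg hg _)]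
    change ltSMul (ballNilIdeal K) hA hg ((p ^ (m + 1) : ℕ) : LTCoeff F) t = 0
    rw [Nat.cast_pow, natCast_eq_neg_ltCoeff, neg_pow, mul_ltSMul, ht, ltSMul_zero]
  rw [← map_nsmul, key, map_zero]

omit hE hEt in
/-- `P(t) = P(t') ↔ t = t'`: `ptHom` is injective (`ptOfZ_injective`). [cite: SilvermanAEC2009, Prop. VII.2.2] -/
theorem ptHom_mk_eq_iff {K : Type} [NontriviallyNormedField K] [IsUltrametricDist K] [CompleteSpace K]
    [Algebra (LTCoeff F) (unitBall K)] [ContinuousSMul (LTCoeff F) (unitBall K)]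
    [hEK : (curveOver K (V.map ((LTCoeff.of F : 𝒪[F] →+* LTCoeff F).comp (padicIntToInteger F p)))).IsElliptic]
    (t t' : (ballNilIdeal K).toIdeal) :
    ptHom K (V.map ((LTCoeff.of F : 𝒪[F] →+* LTCoeff F).comp (padicIntToInteger F p))) ⟨t⟩ =
      ptHom K (V.map ((LTCoeff.of F : 𝒪[F] →+* LTCoeff F).comp (padicIntToInteger F p))) ⟨t'⟩ ↔ t = t' := by
  refine ⟨fun h => ?_, fun h => by rw [h]⟩
  have := ptHom_injective h
  exact (WeierstrassCurve.Pt.ext_iff.mp this)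

/-! ### §3 Naturality: isometric automorphisms fixing `𝒪_F` act on `P(t)` through `t` -/

omit hE hEt in
/-- **`σ(P(t)) = P(ε t)`** for a ring endomorphism `σ` of `K` fixing the coefficients, isometric, restricting to `ε` on `𝒪_K` with `ε(𝔪_K) ⊆ 𝔪_K`
(`zPt_galPointHom` + `eq_ptOfZ_zPt`). [cite: SilvermanAEC2009, Prop. VII.2.2] -/
theorem galPointHom_ptHom_mk {K : Type} [NontriviallyNormedField K] [IsUltrametricDist K] [CompleteSpace K]
    [Algebra (LTCoeff F) (unitBall K)] [ContinuousSMul (LTCoeff F) (unitBall K)]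
    [hEK : (curveOver K (V.map ((LTCoeff.of F : 𝒪[F] →+* LTCoeff F).comp (padicIntToInteger F p)))).IsElliptic]
    (σ : K →+* K) (hσA : ∀ a : LTCoeff F, σ (cK K a) = cK K a) (hiso : ∀ x, ‖σ x‖ = ‖x‖)
    (ε : unitBall K →ₐ[LTCoeff F] unitBall K) (hεm : ∀ x ∈ (ballNilIdeal K).toIdeal, ε x ∈ (ballNilIdeal K).toIdeal)
    (hφ : ∀ x : unitBall K, σ x = ε x) (t : (ballNilIdeal K).toIdeal) :
    galPointHom (W := V.map ((LTCoeff.of F : 𝒪[F] →+* LTCoeff F).comp (padicIntToInteger F p))) σ hσA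
        (ptHom K (V.map ((LTCoeff.of F : 𝒪[F] →+* LTCoeff F).comp (padicIntToInteger F p))) ⟨t⟩) =
      ptHom K (V.map ((LTCoeff.of F : 𝒪[F] →+* LTCoeff F).comp (padicIntToInteger F p))) ⟨mapBallPt ε hεm t⟩ := by
  rw [ptHom_apply, ptHom_apply]
  have ht : ptOfZ K (V.map ((LTCoeff.of F : 𝒪[F] →+* LTCoeff F).comp (padicIntToInteger F p))) t ∈
      kernel (NormedField.valuation (K := K)) (curveOver K (V.map ((LTCoeff.of F : 𝒪[F] →+* LTCoeff F).comp (padicIntToInteger F p)))) :=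
    ptOfZ_mem_kernel t
  have hmem : galPointHom (W := V.map ((LTCoeff.of F : 𝒪[F] →+* LTCoeff F).comp (padicIntToInteger F p))) σ hσA
      (ptOfZ K (V.map ((LTCoeff.of F : 𝒪[F] →+* LTCoeff F).comp (padicIntToInteger F p))) t) ∈
      kernel (NormedField.valuation (K := K)) (curveOver K (V.map ((LTCoeff.of F : 𝒪[F] →+* LTCoeff F).comp (padicIntToInteger F p)))) :=
    galPointHom_mem_kernel σ hσA hiso ht
  rw [eq_ptOfZ_zPt hmem, zPt_galPointHom σ hσA hiso ε hεm hφ ht, zPt_ptOfZ]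

/-- **The division points `[b]_{g,f} λ_{m+1}` give `p^{m+1}`-torsion points of the curve over the Lubin–Tate field `K_π^{m+1}`** (the generic
§2 lemma at `K = K_π^{m+1}`, `t = [b]_{g,f} λ_{m+1}`, with `ltSMul_pow_evalPt₁_hom_genPt` of `LubinTateDivisionPointsOfSeries`).
[cite: CasselsFrohlichANT1967, Ch. VI §3.6 Prop. 6 (a)] [cite: SilvermanAEC2009, Prop. VII.2.2] -/
theorem pow_smul_ptHom_divisionPt_eq_zero (m : ℕ)
    [hEK : (curveOver (ltField (padicIntToInteger F p (-(p : ℤ_[p]))) m)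
      (V.map ((LTCoeff.of F : 𝒪[F] →+* LTCoeff F).comp (padicIntToInteger F p)))).IsElliptic] (b : 𝒪[F]) :
    p ^ (m + 1) • ptHom (ltField (padicIntToInteger F p (-(p : ℤ_[p]))) m)
        (V.map ((LTCoeff.of F : 𝒪[F] →+* LTCoeff F).comp (padicIntToInteger F p)))
        ⟨evalPt₁ (maxNilIdeal F (ltField (padicIntToInteger F p (-(p : ℤ_[p]))) m))
          (hom (isLTRing_LTCoeff hπ) (V.isLTSeries_map_padicIntToInteger_of_tr_eq_zero F ha hP hq)
            (isLTSeries_LTCoeff (padicIntToInteger F p (-(p : ℤ_[p])))) (LTCoeff.of F b))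
          (constantCoeff_hom _ _ _ _) (genPt hπ m)⟩ = 0 := by
  -- the generic lemma, read through the (propositionally equal) group-law instance of the point type over the subfield `K_π^{m+1}`
  -- (`Field`/`DecidableEq` reached along two paths: `IntermediateField.toField`/`instDecidableEq` vs the local `nE`/`Classical`)
  convert pow_smul_ptHom_eq_zero_of_ltSMul_pow_eq_zero V ha hP hq hπ m _
    (ltSMul_pow_evalPt₁_hom_genPt hπ m (V.isLTSeries_map_padicIntToInteger_of_tr_eq_zero F ha hP hq) b) using 4
  -- the two `AddCommGroup` structures on the point type differ only in the (subsingleton) `DecidableEq` instance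
  have hdec : (fun a b : ltField (padicIntToInteger F p (-(p : ℤ_[p]))) m => a.instDecidableEq b) =
      (fun a b => Classical.propDecidable (a = b)) := Subsingleton.elim _ _
  rw [hdec]

/-- ★ **`P([a]_{g,f}λ) = P([b]_{g,f}λ) ↔ π^{m+1} ∣ a − b`**: the torsion points built from the division points are parametrised EXACTLY by
`𝒪_F/π^{m+1}` (`ptHom` injective + `evalPt₁_hom_genPt_eq_iff`). [cite: CasselsFrohlichANT1967, Ch. VI §3.6 Prop. 6 (a)] -/
theorem ptHom_divisionPt_eq_iff (m : ℕ)
    [hEK : (curveOver (ltField (padicIntToInteger F p (-(p : ℤ_[p]))) m)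
      (V.map ((LTCoeff.of F : 𝒪[F] →+* LTCoeff F).comp (padicIntToInteger F p)))).IsElliptic] (a b : 𝒪[F]) :
    ptHom (ltField (padicIntToInteger F p (-(p : ℤ_[p]))) m) (V.map ((LTCoeff.of F : 𝒪[F] →+* LTCoeff F).comp (padicIntToInteger F p)))
        ⟨evalPt₁ (maxNilIdeal F (ltField (padicIntToInteger F p (-(p : ℤ_[p]))) m))
          (hom (isLTRing_LTCoeff hπ) (V.isLTSeries_map_padicIntToInteger_of_tr_eq_zero F ha hP hq)
            (isLTSeries_LTCoeff (padicIntToInteger F p (-(p : ℤ_[p])))) (LTCoeff.of F a))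
          (constantCoeff_hom _ _ _ _) (genPt hπ m)⟩ =
      ptHom (ltField (padicIntToInteger F p (-(p : ℤ_[p]))) m) (V.map ((LTCoeff.of F : 𝒪[F] →+* LTCoeff F).comp (padicIntToInteger F p)))
        ⟨evalPt₁ (maxNilIdeal F (ltField (padicIntToInteger F p (-(p : ℤ_[p]))) m))
          (hom (isLTRing_LTCoeff hπ) (V.isLTSeries_map_padicIntToInteger_of_tr_eq_zero F ha hP hq)
            (isLTSeries_LTCoeff (padicIntToInteger F p (-(p : ℤ_[p])))) (LTCoeff.of F b))
          (constantCoeff_hom _ _ _ _) (genPt hπ m)⟩ ↔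
      (padicIntToInteger F p (-(p : ℤ_[p]))) ^ (m + 1) ∣ a - b := by
  rw [ptHom_mk_eq_iff]
  exact evalPt₁_hom_genPt_eq_iff hπ m (V.isLTSeries_map_padicIntToInteger_of_tr_eq_zero F ha hP hq)

/-- ★ **Galois on the division points, as points of `𝔪_{K_π^{m+1}}`**: for `σ ∈ Γ_F` with restriction `σ'` to the (Galois) Lubin–Tate field,
`σ'([b]_{g,f} λ_{m+1}) = [χ_π(σ) b]_{g,f} λ_{m+1}` (`absGal_smul_evalPt₁_hom_genPt` read back from `F̄`). [cite: LubinTate1965, §2 Thm. 2 and Cor.]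
[cite: CasselsFrohlichANT1967, Ch. VI §3.4 Thm. 3 (b)] -/
theorem mapPt_restrictNormal_divisionPt (m : ℕ) (σ : Field.absoluteGaloisGroup F) (b : 𝒪[F]) :
    haveI := isGalois_ltField hπ m
    mapPt (AlgEquiv.restrictNormalHom (ltField (padicIntToInteger F p (-(p : ℤ_[p]))) m) (Field.absoluteGaloisGroup.toAlgEquiv F σ))
        (evalPt₁ (maxNilIdeal F (ltField (padicIntToInteger F p (-(p : ℤ_[p]))) m))
          (hom (isLTRing_LTCoeff hπ) (V.isLTSeries_map_padicIntToInteger_of_tr_eq_zero F ha hP hq)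
            (isLTSeries_LTCoeff (padicIntToInteger F p (-(p : ℤ_[p])))) (LTCoeff.of F b))
          (constantCoeff_hom _ _ _ _) (genPt hπ m)) =
      evalPt₁ (maxNilIdeal F (ltField (padicIntToInteger F p (-(p : ℤ_[p]))) m))
        (hom (isLTRing_LTCoeff hπ) (V.isLTSeries_map_padicIntToInteger_of_tr_eq_zero F ha hP hq)
          (isLTSeries_LTCoeff (padicIntToInteger F p (-(p : ℤ_[p])))) (LTCoeff.of F ((lubinTateChar hπ σ : 𝒪[F]) * b)))
        (constantCoeff_hom _ _ _ _) (genPt hπ m) := by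
  haveI := isGalois_ltField hπ m
  apply Subtype.ext; apply Subtype.ext; apply Subtype.ext
  rw [coe_mapPt]
  have h := absGal_smul_evalPt₁_hom_genPt hπ m (V.isLTSeries_map_padicIntToInteger_of_tr_eq_zero F ha hP hq) σ b
  rw [Field.absoluteGaloisGroup.smul_def] at h
  exact (AlgEquiv.restrictNormal_commutes (Field.absoluteGaloisGroup.toAlgEquiv F σ)
    (ltField (padicIntToInteger F p (-(p : ℤ_[p]))) m) _).trans h

end Local

end Summit.BirchSwinnertonDyer.BirchSwinnertonDyer.Theorems.SmallImageRttCharRoad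

end
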